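import Summits.Ventures.LatticeQCDFlow.Scoring.UNOnePlaquetteBesselDeterminant
import Literature.RingTheory.SymmetricFunctions.SchurPolynomials
import HarnessLib

/-!
# Weyl's formula for complex class functions on `U(N)` (Bochner form), the Parseval pairing `∫ P(e^{iθ}) conj Q(e^{iθ}) dθ = (2π)^N Σ_d [x^d]P·[x^d]Q`, and the column alternant at the torus point

HONEST FRAMING: exact (Metropolis-corrected) sampling algorithms for lattice gauge theory;
figures of merit are autocorrelation/cost numbers at stated couplings and volumes; no
continuum-physics claim.

Venture `LatticeQCDFlow` (cell pub-lqcd), sub-topic `Scoring`; FANOUT row 5 (`s0-sun-a`), GEN-23.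
NEW WORK of the cell (placement rule).  The polarised companion of `TorusParsevalAlternant` (which is the case
`P = Q`), for the torus-side computation of mixed trace moments of a Haar unitary such as
`∫_{U(N)} conj(det U) (tr U)^N dU` (the `SU(N)` baryon vertex, sequel `SUNBaryonVertex`):

* §0 WEYL'S INTEGRATION FORMULA FOR `U(N)` IN BOCHNER FORM, for non-negative / real / complex continuous class
  functions (`integral_unitaryGroup_eq_integral_cube_of_nonneg/_real/_complex`, from the tree's `ℝ≥0∞` class-function
  form `lintegral_unitaryGroup_eq_angleIntegral` by shifting a bounded function to a non-negative one), and
  `∫_{SU(N)} |tr V|^{2n} dV = ∫_{U(N)} |tr U|^{2n} dU` (`integral_haar_specialUnitaryGroup_norm_trace_pow_eq`: the special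
  part `u ↦ ζ(u)⁻¹u` of the tree's `WeylIntegrationSpecialUnitary` pushes Haar to Haar and preserves `|tr|`);
* `integral_cube_eval₂_mul_conj_eval₂`: for integer polynomials `P`, `Q` in `N` variables,
  **`∫_{(−π,π]^N} P(e^{iθ}) · conj Q(e^{iθ}) dθ = (2π)^N Σ_{d ∈ supp P} [x^d]P · [x^d]Q`** (orthogonality of the
  characters of the torus, the tree's `integral_cube_prod_cexp`);
* `alternant_rho_add_one_eq`: at any point `z`, `a_{ρ+1}(z) = (Π_b z_b) · a_ρ(z)` (a column scaling of the
  Vandermonde determinant), so that at the torus point `conj(Π_b e^{iθ_b}) (Σ_b e^{iθ_b})^N |a_ρ|² =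
  (a_ρ p_1^N)(e^{iθ}) · conj(a_{ρ+1}(e^{iθ}))` (`eval₂_alternant_mul_psum_pow_mul_conj`).

Parents: row 5's `UNOnePlaquetteBesselDeterminant` (for the tree's Weyl-integration files) and the tree's
`SchurPolynomials`.  No `def`, no named fact, 0 sorry.
-/

noncomputable section

open Real MeasureTheory Finset Complex Equiv
open scoped ENNReal ComplexConjugate
open Literature.MathematicalPhysics.QuantumFieldTheory (haarProbability)
open Literature.RepresentationTheory.CompactGroups.WeylIntegration
open Literature.RingTheory.SymmetricFunctions.SymmPoly (alternant rho map_alternant)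

namespace Summit.Ventures.LatticeQCDFlow.Scoring

variable {N : ℕ}

/-! ### 0. Weyl's integral formula for real and complex continuous class functions on `U(N)` (Bochner form) -/

/-- A continuous function on `U(N)` composed with the torus point, times the Vandermonde weight, is integrable on
the cube. -/
theorem integrable_cube_comp_torusPt_mul_prod {h : Matrix.unitaryGroup (Fin N) ℂ → ℝ} (hc : Continuous h) :
    Integrable (fun θ : Fin N → ℝ =>
        h ((torusPt θ : Literature.LinearAlgebra.Matrix.diagonalTorus (Fin N)) : Matrix.unitaryGroup (Fin N) ℂ) *
          ∏ p : OD (Fin N), ‖cexp (θ p.1.1 * I) - cexp (θ p.1.2 * I)‖ ^ 2)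
      (Measure.pi fun _ : Fin N => (volume : Measure ℝ).restrict (Set.Ioc (-π) π)) := by
  obtain ⟨M, hM⟩ : ∃ M, ∀ u, ‖h u‖ ≤ M := by
    obtain ⟨M, hM⟩ := isCompact_univ.exists_bound_of_continuousOn hc.continuousOn
    exact ⟨M, fun u => hM u (Set.mem_univ u)⟩
  have hcont : Continuous fun θ : Fin N → ℝ =>
      h ((torusPt θ : Literature.LinearAlgebra.Matrix.diagonalTorus (Fin N)) : Matrix.unitaryGroup (Fin N) ℂ) *
        ∏ p : OD (Fin N), ‖cexp (θ p.1.1 * I) - cexp (θ p.1.2 * I)‖ ^ 2 :=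
    (hc.comp (continuous_subtype_val.comp continuous_torusPt)).mul (continuous_finsetProd _ fun p _ => by fun_prop)
  refine Integrable.mono' (integrable_const (M * (2 ^ Fintype.card (OD (Fin N))) ^ 2)) hcont.aestronglyMeasurable
    (Filter.Eventually.of_forall fun θ => ?_)
  rw [norm_mul, Real.norm_of_nonneg (Finset.prod_nonneg fun p _ => sq_nonneg _), prod_OD_norm_sub_sq_eq_norm_vdm_sq]
  exact mul_le_mul (hM _) (norm_vdm_sq_le θ) (sq_nonneg _) ((norm_nonneg (h 1)).trans (hM 1))

/-- **Weyl's formula, Bochner form, for a NON-NEGATIVE continuous class function** `g` on `U(N)`: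
`∫_{U(N)} g dU = ((2π)^N N!)⁻¹ ∫_{(−π,π]^N} g(diag e^{iθ}) Π_{j≺k}|e^{iθ_j} − e^{iθ_k}|² dθ` (the tree's
`lintegral_unitaryGroup_eq_angleIntegral`, transported to Bochner integrals). -/
theorem integral_unitaryGroup_eq_integral_cube_of_nonneg {g : Matrix.unitaryGroup (Fin N) ℂ → ℝ}
    (hc : Continuous g) (hcl : ∀ a u, g (a * u * a⁻¹) = g u) (h0 : ∀ u, 0 ≤ g u) :
    ∫ u, g u ∂(haarProbability (Matrix.unitaryGroup (Fin N) ℂ))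
      = ((2 * π) ^ N * N.factorial)⁻¹ *
          ∫ θ, g ((torusPt θ : Literature.LinearAlgebra.Matrix.diagonalTorus (Fin N)) : Matrix.unitaryGroup (Fin N) ℂ) *
              ∏ p : OD (Fin N), ‖cexp (θ p.1.1 * I) - cexp (θ p.1.2 * I)‖ ^ 2
            ∂(Measure.pi fun _ : Fin N => (volume : Measure ℝ).restrict (Set.Ioc (-π) π)) := by
  obtain ⟨M, hM⟩ : ∃ M, ∀ u, ‖g u‖ ≤ M := by
    obtain ⟨M, hM⟩ := isCompact_univ.exists_bound_of_continuousOn hc.continuousOn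
    exact ⟨M, fun u => hM u (Set.mem_univ u)⟩
  have hF : Measurable fun u : Matrix.unitaryGroup (Fin N) ℂ => ENNReal.ofReal (g u) :=
    ENNReal.measurable_ofReal.comp hc.measurable
  have hclF : ∀ a u : Matrix.unitaryGroup (Fin N) ℂ, ENNReal.ofReal (g (a * u * a⁻¹)) = ENNReal.ofReal (g u) :=
    fun a u => by rw [hcl]
  have key := lintegral_unitaryGroup_eq_angleIntegral hF hclF
  rw [angleIntegral, show (volume : Measure (Fin N → ℝ)).restrict (Set.pi Set.univ fun _ => Set.Ioc (-π) π) =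
    Measure.pi fun _ : Fin N => (volume : Measure ℝ).restrict (Set.Ioc (-π) π) from Measure.restrict_pi_pi _ _] at key
  have hprod : ∀ θ : Fin N → ℝ,
      ENNReal.ofReal (g ((torusPt θ : Literature.LinearAlgebra.Matrix.diagonalTorus (Fin N)) :
        Matrix.unitaryGroup (Fin N) ℂ)) * ENNReal.ofReal (∏ p : OD (Fin N), ‖cexp (θ p.1.1 * I) - cexp (θ p.1.2 * I)‖ ^ 2)
      = ENNReal.ofReal (g ((torusPt θ : Literature.LinearAlgebra.Matrix.diagonalTorus (Fin N)) :
          Matrix.unitaryGroup (Fin N) ℂ) * ∏ p : OD (Fin N), ‖cexp (θ p.1.1 * I) - cexp (θ p.1.2 * I)‖ ^ 2) :=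
    fun θ => (ENNReal.ofReal_mul (h0 _)).symm
  simp_rw [hprod] at key
  have hintU : Integrable g (haarProbability (Matrix.unitaryGroup (Fin N) ℂ)) :=
    Integrable.mono' (integrable_const M) hc.aestronglyMeasurable (Filter.Eventually.of_forall hM)
  rw [← ofReal_integral_eq_lintegral_ofReal hintU (Filter.Eventually.of_forall h0),
    ← ofReal_integral_eq_lintegral_ofReal (integrable_cube_comp_torusPt_mul_prod hc)
      (Filter.Eventually.of_forall fun θ => mul_nonneg (h0 _) (Finset.prod_nonneg fun p _ => sq_nonneg _))] at key
  have hC : (ENNReal.ofReal (2 * π) ^ Fintype.card (Fin N) * ((Fintype.card (Fin N)).factorial : ℝ≥0∞))⁻¹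
      = ENNReal.ofReal (((2 * π) ^ N * N.factorial)⁻¹) := by
    rw [Fintype.card_fin, ← ENNReal.ofReal_pow Real.two_pi_pos.le, ← ENNReal.ofReal_natCast,
      ← ENNReal.ofReal_mul (by positivity), ENNReal.ofReal_inv_of_pos (by positivity)]
  rw [hC, ← ENNReal.ofReal_mul (by positivity)] at key
  exact (ENNReal.ofReal_eq_ofReal_iff (integral_nonneg h0) (mul_nonneg (by positivity)
    (integral_nonneg fun θ => mul_nonneg (h0 _) (Finset.prod_nonneg fun p _ => sq_nonneg _)))).mp key

/-- **Weyl's formula, Bochner form, for a REAL continuous class function** `h` on `U(N)`. -/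
theorem integral_unitaryGroup_eq_integral_cube_real {h : Matrix.unitaryGroup (Fin N) ℂ → ℝ}
    (hc : Continuous h) (hcl : ∀ a u, h (a * u * a⁻¹) = h u) :
    ∫ u, h u ∂(haarProbability (Matrix.unitaryGroup (Fin N) ℂ))
      = ((2 * π) ^ N * N.factorial)⁻¹ *
          ∫ θ, h ((torusPt θ : Literature.LinearAlgebra.Matrix.diagonalTorus (Fin N)) : Matrix.unitaryGroup (Fin N) ℂ) *
              ∏ p : OD (Fin N), ‖cexp (θ p.1.1 * I) - cexp (θ p.1.2 * I)‖ ^ 2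
            ∂(Measure.pi fun _ : Fin N => (volume : Measure ℝ).restrict (Set.Ioc (-π) π)) := by
  obtain ⟨M, hM⟩ : ∃ M, ∀ u, ‖h u‖ ≤ M := by
    obtain ⟨M, hM⟩ := isCompact_univ.exists_bound_of_continuousOn hc.continuousOn
    exact ⟨M, fun u => hM u (Set.mem_univ u)⟩
  have hM0 : 0 ≤ M := (norm_nonneg _).trans (hM 1)
  have h1 := integral_unitaryGroup_eq_integral_cube_of_nonneg (g := fun u => h u + M) (hc.add continuous_const)
    (fun a u => by simp only [hcl]) (fun u => by linarith [hM u, neg_le_of_abs_le (Real.norm_eq_abs _ ▸ hM u)])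
  have h2 := integral_unitaryGroup_eq_integral_cube_of_nonneg (N := N) (g := fun _ => M) continuous_const
    (fun a u => rfl) (fun u => hM0)
  have hintU : Integrable h (haarProbability (Matrix.unitaryGroup (Fin N) ℂ)) :=
    Integrable.mono' (integrable_const M) hc.aestronglyMeasurable (Filter.Eventually.of_forall hM)
  have hI1 := integrable_cube_comp_torusPt_mul_prod hc
  have hI2 := integrable_cube_comp_torusPt_mul_prod (N := N) (h := fun _ => M) continuous_const
  rw [integral_add hintU (integrable_const M)] at h1
  simp_rw [add_mul] at h1
  rw [integral_add hI1 hI2, mul_add, ← h2] at h1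
  linarith

/-- **Weyl's formula, Bochner form, for a COMPLEX continuous class function** `f` on `U(N)`:
`∫_{U(N)} f dU = ((2π)^N N!)⁻¹ ∫_{(−π,π]^N} f(diag e^{iθ}) Π_{j≺k}|e^{iθ_j} − e^{iθ_k}|² dθ`. -/
theorem integral_unitaryGroup_eq_integral_cube_complex {f : Matrix.unitaryGroup (Fin N) ℂ → ℂ}
    (hc : Continuous f) (hcl : ∀ a u, f (a * u * a⁻¹) = f u) :
    ∫ u, f u ∂(haarProbability (Matrix.unitaryGroup (Fin N) ℂ))
      = ((((2 * π) ^ N * N.factorial)⁻¹ : ℝ) : ℂ) *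
          ∫ θ, f ((torusPt θ : Literature.LinearAlgebra.Matrix.diagonalTorus (Fin N)) : Matrix.unitaryGroup (Fin N) ℂ) *
              ((∏ p : OD (Fin N), ‖cexp (θ p.1.1 * I) - cexp (θ p.1.2 * I)‖ ^ 2 : ℝ) : ℂ)
            ∂(Measure.pi fun _ : Fin N => (volume : Measure ℝ).restrict (Set.Ioc (-π) π)) := by
  obtain ⟨M, hM⟩ : ∃ M, ∀ u, ‖f u‖ ≤ M := by
    obtain ⟨M, hM⟩ := isCompact_univ.exists_bound_of_continuousOn hc.continuousOn
    exact ⟨M, fun u => hM u (Set.mem_univ u)⟩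
  have hintU : Integrable f (haarProbability (Matrix.unitaryGroup (Fin N) ℂ)) :=
    Integrable.mono' (integrable_const M) hc.aestronglyMeasurable (Filter.Eventually.of_forall hM)
  have hcontC : Continuous fun θ : Fin N → ℝ =>
      f ((torusPt θ : Literature.LinearAlgebra.Matrix.diagonalTorus (Fin N)) : Matrix.unitaryGroup (Fin N) ℂ) *
        ((∏ p : OD (Fin N), ‖cexp (θ p.1.1 * I) - cexp (θ p.1.2 * I)‖ ^ 2 : ℝ) : ℂ) :=
    (hc.comp (continuous_subtype_val.comp continuous_torusPt)).mul
      (Complex.continuous_ofReal.comp (continuous_finsetProd _ fun p _ => by fun_prop))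
  have hintC : Integrable (fun θ : Fin N → ℝ =>
      f ((torusPt θ : Literature.LinearAlgebra.Matrix.diagonalTorus (Fin N)) : Matrix.unitaryGroup (Fin N) ℂ) *
        ((∏ p : OD (Fin N), ‖cexp (θ p.1.1 * I) - cexp (θ p.1.2 * I)‖ ^ 2 : ℝ) : ℂ))
      (Measure.pi fun _ : Fin N => (volume : Measure ℝ).restrict (Set.Ioc (-π) π)) := by
    refine Integrable.mono' (integrable_const (M * (2 ^ Fintype.card (OD (Fin N))) ^ 2)) hcontC.aestronglyMeasurable
      (Filter.Eventually.of_forall fun θ => ?_)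
    rw [norm_mul, Complex.norm_real, Real.norm_of_nonneg (Finset.prod_nonneg fun p _ => sq_nonneg _),
      prod_OD_norm_sub_sq_eq_norm_vdm_sq]
    exact mul_le_mul (hM _) (norm_vdm_sq_le θ) (sq_nonneg _) ((norm_nonneg (f 1)).trans (hM 1))
  have hre := integral_unitaryGroup_eq_integral_cube_real (h := fun u => (f u).re) (Complex.continuous_re.comp hc)
    (fun a u => by simp only [hcl])
  have him := integral_unitaryGroup_eq_integral_cube_real (h := fun u => (f u).im) (Complex.continuous_im.comp hc)
    (fun a u => by simp only [hcl])
  have hreC := integral_re hintC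
  have himC := integral_im hintC
  simp only [RCLike.re_to_complex, RCLike.im_to_complex, Complex.mul_re, Complex.mul_im, Complex.ofReal_re,
    Complex.ofReal_im, mul_zero, sub_zero, zero_add] at hreC himC
  apply Complex.ext
  · rw [show (∫ u, f u ∂(haarProbability (Matrix.unitaryGroup (Fin N) ℂ))).re
        = ∫ u, (f u).re ∂(haarProbability (Matrix.unitaryGroup (Fin N) ℂ)) from (integral_re hintU).symm, hre,
      Complex.re_ofReal_mul, ← hreC]
  · rw [show (∫ u, f u ∂(haarProbability (Matrix.unitaryGroup (Fin N) ℂ))).im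
        = ∫ u, (f u).im ∂(haarProbability (Matrix.unitaryGroup (Fin N) ℂ)) from (integral_im hintU).symm, him,
      Complex.im_ofReal_mul, ← himC]

/-! ### 0b. `SU(N)` versus `U(N)`: the special part preserves `|tr|` -/

/-- **THE SAME FOR `SU(N)`**: `∫_{SU(N)} |tr V|^{2n} dV = ∫_{U(N)} |tr U|^{2n} dU` — the special part
`u ↦ ζ(u)⁻¹u` (`|ζ| = 1`) pushes the Haar probability of `U(N)` to that of `SU(N)` (the tree's
`map_specialPart_haarProbability`) and does not change `|tr|`. -/
theorem integral_haar_specialUnitaryGroup_norm_trace_pow_eq (N n : ℕ) :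
    ∫ V, ‖((V : Matrix.specialUnitaryGroup (Fin N) ℂ) : Matrix (Fin N) (Fin N) ℂ).trace‖ ^ (2 * n)
        ∂(haarProbability (Matrix.specialUnitaryGroup (Fin N) ℂ))
      = ∫ u, ‖((u : Matrix.unitaryGroup (Fin N) ℂ) : Matrix (Fin N) (Fin N) ℂ).trace‖ ^ (2 * n)
          ∂(haarProbability (Matrix.unitaryGroup (Fin N) ℂ)) := by
  have hc : Continuous fun V : Matrix.specialUnitaryGroup (Fin N) ℂ =>
      ‖((V : Matrix.specialUnitaryGroup (Fin N) ℂ) : Matrix (Fin N) (Fin N) ℂ).trace‖ ^ (2 * n) :=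
    (continuous_id.matrix_trace.comp continuous_subtype_val).norm.pow _
  rw [← map_specialPart_haarProbability, integral_map measurable_specialPart.aemeasurable hc.aestronglyMeasurable]
  refine integral_congr_ae (Filter.Eventually.of_forall fun u => ?_)
  simp only [coe_specialPart, Matrix.trace_smul, smul_eq_mul, norm_mul, norm_inv, norm_detPhase, inv_one, one_mul]

/-! ### 1. The Parseval pairing -/

/-- **The Parseval pairing on the torus**: `∫_{(−π,π]^N} P(e^{iθ}) conj Q(e^{iθ}) dθ = (2π)^N Σ_{d ∈ supp P} [x^d]P [x^d]Q`. -/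
theorem integral_cube_eval₂_mul_conj_eval₂ (P Q : MvPolynomial (Fin N) ℤ) :
    ∫ θ, MvPolynomial.eval₂ (Int.castRingHom ℂ) (fun b => cexp (θ b * I)) P *
        conj (MvPolynomial.eval₂ (Int.castRingHom ℂ) (fun b => cexp (θ b * I)) Q)
        ∂(Measure.pi fun _ : Fin N => (volume : Measure ℝ).restrict (Set.Ioc (-π) π))
      = (2 * π : ℂ) ^ N * ∑ d ∈ P.support, ((P.coeff d : ℤ) : ℂ) * ((Q.coeff d : ℤ) : ℂ) := by
  have hpow : ∀ (θ : Fin N → ℝ) (d : Fin N →₀ ℕ), ∏ b, cexp (θ b * I) ^ (d b) = ∏ b, cexp ((d b : ℕ) * (θ b * I)) :=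
    fun θ d => Finset.prod_congr rfl fun b _ => by rw [Complex.exp_nat_mul]
  have hexp : ∀ θ : Fin N → ℝ,
      MvPolynomial.eval₂ (Int.castRingHom ℂ) (fun b => cexp (θ b * I)) P *
        conj (MvPolynomial.eval₂ (Int.castRingHom ℂ) (fun b => cexp (θ b * I)) Q)
        = ∑ d ∈ P.support, ∑ e ∈ Q.support, ((P.coeff d : ℤ) : ℂ) * ((Q.coeff e : ℤ) : ℂ) *
            ∏ b, cexp ((((d b : ℕ) : ℤ) - ((e b : ℕ) : ℤ) : ℤ) * θ b * I) := by
    intro θ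
    rw [MvPolynomial.eval₂_eq', MvPolynomial.eval₂_eq']
    simp_rw [hpow, eq_intCast]
    rw [map_sum, Finset.sum_mul_sum]
    refine Finset.sum_congr rfl fun d _ => Finset.sum_congr rfl fun e _ => ?_
    rw [map_mul, map_prod, map_intCast]
    have hconj : ∀ b, conj (cexp ((e b : ℕ) * (θ b * I))) = cexp (-((e b : ℕ) * (θ b * I))) := by
      intro b
      rw [← Complex.exp_conj, map_mul, map_natCast, map_mul, Complex.conj_ofReal, Complex.conj_I]
      ring_nf
    simp_rw [hconj]
    rw [mul_mul_mul_comm, ← Finset.prod_mul_distrib]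
    congr 1
    refine Finset.prod_congr rfl fun b _ => ?_
    rw [← Complex.exp_add]
    congr 1
    push_cast
    ring
  have hint : ∀ m : Fin N → ℤ, Integrable (fun θ : Fin N → ℝ => ∏ b, cexp (m b * θ b * I))
      (Measure.pi fun _ : Fin N => (volume : Measure ℝ).restrict (Set.Ioc (-π) π)) := by
    intro m
    refine Integrable.mono' (integrable_const (1 : ℝ)) ?_ (Filter.Eventually.of_forall fun θ => ?_)
    · exact (continuous_finsetProd _ fun b _ => by fun_prop).aestronglyMeasurable
    · rw [norm_prod]
      refine le_of_eq (Finset.prod_eq_one fun b _ => ?_)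
      rw [show (m b : ℂ) * (θ b : ℂ) * I = (((m b : ℝ) * θ b : ℝ) : ℂ) * I by push_cast; ring]
      exact Complex.norm_exp_ofReal_mul_I _
  simp_rw [hexp]
  rw [integral_finsetSum _ (fun d _ => integrable_finsetSum _ fun e _ => (hint _).const_mul _)]
  simp_rw [integral_finsetSum _ (fun e _ => (hint _).const_mul _), integral_const_mul]
  have hI : ∀ d e : Fin N →₀ ℕ,
      ∫ θ : Fin N → ℝ, ∏ b, cexp ((((d b : ℕ) : ℤ) - ((e b : ℕ) : ℤ) : ℤ) * θ b * I)
        ∂(Measure.pi fun _ : Fin N => (volume : Measure ℝ).restrict (Set.Ioc (-π) π))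
        = if d = e then (2 * π : ℂ) ^ N else 0 := by
    intro d e
    have h := integral_cube_prod_cexp (n := Fin N) (fun b => ((d b : ℕ) : ℤ) - ((e b : ℕ) : ℤ))
    simp only [Fintype.card_fin] at h
    rw [h]
    congr 1
    simp only [funext_iff, Pi.zero_apply, sub_eq_zero, Nat.cast_inj, eq_iff_iff]
    exact ⟨fun h' => Finsupp.ext h', fun h' b => by rw [h']⟩
  simp_rw [hI, mul_ite, mul_zero, Finset.sum_ite_eq, Finset.mul_sum]
  refine Finset.sum_congr rfl fun d _ => ?_
  split_ifs with h
  · ring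
  · rw [MvPolynomial.notMem_support_iff.mp h, Int.cast_zero, mul_zero, mul_zero]

/-! ### 2. The column alternant at a point: `a_{ρ+1}(z) = (Π_b z_b) a_ρ(z)` -/

/-- `a_{μ+1}(z) = (Π_b z_b) · a_μ(z)` for any exponent vector `μ` (scale row `i` of `(z_i^{μ_j})` by `z_i`). -/
theorem alternant_add_one_eq {R : Type*} [CommRing R] (z : Fin N → R) (μ : Fin N → ℕ) :
    alternant z (fun j => μ j + 1) = (∏ b, z b) * alternant z μ := by
  rw [alternant, alternant, ← Matrix.det_mul_column]
  congr 1
  ext i j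
  simp [Matrix.of_apply, pow_succ, mul_comm]

/-- At the torus point: `(a_ρ p_1^n)(e^{iθ}) · conj(a_{ρ+1}(e^{iθ})) = conj(Π_b e^{iθ_b}) (Σ_b e^{iθ_b})^n |a_ρ(e^{iθ})|²`
— the angle integrand of `∫_{U(N)} conj(det U) (tr U)^n dU` in Weyl's formula, up to `|a_ρ|² = |Δ|²`. -/
theorem eval₂_alternant_mul_psum_pow_mul_conj (θ : Fin N → ℝ) (n : ℕ) :
    MvPolynomial.eval₂ (Int.castRingHom ℂ) (fun b => cexp (θ b * I))
        (alternant (fun i => (MvPolynomial.X i : MvPolynomial (Fin N) ℤ)) (rho N) * MvPolynomial.psum (Fin N) ℤ 1 ^ n) *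
      conj (MvPolynomial.eval₂ (Int.castRingHom ℂ) (fun b => cexp (θ b * I))
        (alternant (fun i => (MvPolynomial.X i : MvPolynomial (Fin N) ℤ)) fun j => rho N j + 1))
      = conj (∏ b, cexp (θ b * I)) * (∑ b, cexp (θ b * I)) ^ n *
          ((‖alternant (fun b => cexp (θ b * I)) (rho N)‖ ^ 2 : ℝ) : ℂ) := by
  have hX : ∀ μ : Fin N → ℕ, MvPolynomial.eval₂ (Int.castRingHom ℂ) (fun b => cexp (θ b * I))
      (alternant (fun i => (MvPolynomial.X i : MvPolynomial (Fin N) ℤ)) μ) = alternant (fun b => cexp (θ b * I)) μ := by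
    intro μ
    have h := map_alternant (MvPolynomial.eval₂Hom (Int.castRingHom ℂ) (fun b => cexp (θ b * I)))
      (fun i => (MvPolynomial.X i : MvPolynomial (Fin N) ℤ)) μ
    rw [MvPolynomial.coe_eval₂Hom] at h
    rw [h]
    congr 1
    funext i
    simp
  rw [MvPolynomial.eval₂_mul, MvPolynomial.eval₂_pow, MvPolynomial.psum_one, MvPolynomial.eval₂_sum, hX, hX,
    alternant_add_one_eq, map_mul, ← Complex.normSq_eq_norm_sq, ← Complex.mul_conj]
  simp_rw [MvPolynomial.eval₂_X]
  ring

end Summit.Ventures.LatticeQCDFlow.Scoring
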